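import Literature.Topology.FourManifolds.KhPolyakMove
import Literature.Topology.FourManifolds.KhAntiBigonRotate
import Literature.Topology.FourManifolds.GaussDiagramParityRMoves
import HarnessLib

/-!
# Invariance of Khovanov homology under all oriented Reidemeister moves of Gauss diagrams

Sibling file of `KhPolyakMove.lean`. That file assembles the per-move chain-homotopy equivalences
of Khovanov (2000), §5 into invariance of `Kh^{i,j}` under `GaussDiagram.PolyakMove` and
`GaussDiagram.Equiv` (`nonempty_iso_khovanovHomology_of_equiv_holds`). The move set `PolyakMove`
(all first moves, the co-oriented second moves `Ω2a/b`, the braid-like third move) lacks the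
anti-parallel second moves `Ω2c/Ω2d`, which by Polyak (2010), Thm. 1.2 it does not generate; the
enlarged move set is `GaussDiagram.RMove` (`GaussDiagramsRMoves.lean`) with its equivalence
`GaussDiagram.REquiv`. With the anti-parallel bigon (`nonempty_iso_khovanovHomology_omega2c`,
`KhAntiBigonRotate`) and Manturov's parity projection for `RMove` (`eqvGen_rMove_allEven_of_rEquiv`,
`GaussDiagramParityRMoves`) the same assembly gives:

* `nonempty_iso_khovanovHomology_of_rMove_of_allEven`, `nonempty_iso_khovanovHomology_of_rMove` —
  every move of `RMove` between all-even, resp. realisable, Gauss diagrams preserves `Kh^{i,j}`;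
* `nonempty_iso_khovanovHomology_of_eqvGen_rMove_allEven` — so does every chain of such moves
  through all-even diagrams;
* `nonempty_iso_khovanovHomology_of_rEquiv_of_allEven`, `nonempty_iso_khovanovHomology_of_rEquiv` —
  **two all-even, resp. realisable, Gauss diagrams related by `REquiv` (all oriented Reidemeister
  moves, possibly through non-realisable diagrams) have isomorphic Khovanov homology in every
  bidegree.**

Everything is proved; no definition and no named fact is introduced.

## References

* M. Khovanov, *A categorification of the Jones polynomial*, Duke Math. J. 101 (2000), Thm. 1,
  §5. [cite: Khovanov2000, Thm. 1]
* D. Bar-Natan, *On Khovanov's categorification of the Jones polynomial*, Algebr. Geom. Topol. 2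
  (2002), Thm. 2, §4. [cite: BarNatan2002, §4]
* M. Polyak, *Minimal generating sets of Reidemeister moves*, Quantum Topol. 1 (2010), Thm. 1.2.
  [cite: Polyak2010, Thm 1.2]
* V. O. Manturov, *Free knots and parity* (2012), §3.2, Thm. 2. [cite: Manturov2011, §3.2 Thm. 2]
-/

open CategoryTheory

noncomputable section

namespace Literature.Topology.FourManifolds

namespace GaussDiagram

/-- **Khovanov homology is invariant under every move of `RMove` between all-even Gauss
diagrams**: the Polyak moves by `nonempty_iso_khovanovHomology_of_polyakMove_of_allEven`, the
anti-parallel second move by `nonempty_iso_khovanovHomology_omega2c` under the merge-or-split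
dichotomy of the all-even target. Khovanov (2000), Thm. 1, §5.3. [cite: Khovanov2000, Thm. 1] -/
theorem nonempty_iso_khovanovHomology_of_rMove_of_allEven {G G' : GaussDiagram} (h : RMove G G')
    (hG : G.AllEven) (hG' : G'.AllEven) (i j : ℤ) :
    Nonempty (G.khovanovHomology i j ≅ G'.khovanovHomology i j) := by
  cases h with
  | polyak h => exact nonempty_iso_khovanovHomology_of_polyakMove_of_allEven h hG hG' i j
  | omega2c o u o' u' ε hover hunder =>
    obtain ⟨e⟩ := G.nonempty_iso_khovanovHomology_omega2c o u o' u' ε hover hunder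
      (fun _ _ hτ ↦ isMergeAt_or_isSplitAt_of_overPos_mod_two_ne hG' hτ) i j
    exact ⟨e.symm⟩

/-- **Khovanov homology is invariant under every move of `RMove` between Gauss diagrams of
knots** (realisable diagrams are all-even, Gauss's parity condition). [cite: Khovanov2000, Thm. 1] -/
theorem nonempty_iso_khovanovHomology_of_rMove {G G' : GaussDiagram} (h : RMove G G')
    (hG : ∃ K : Knot, K.HasGaussDiagram G) (hG' : ∃ K : Knot, K.HasGaussDiagram G') (i j : ℤ) :
    Nonempty (G.khovanovHomology i j ≅ G'.khovanovHomology i j) := by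
  obtain ⟨K, hK⟩ := hG
  obtain ⟨K', hK'⟩ := hG'
  exact nonempty_iso_khovanovHomology_of_rMove_of_allEven h hK.allEven hK'.allEven i j

/-- **Khovanov homology is invariant along every chain of moves of `RMove` through all-even Gauss
diagrams** (the relation of `GaussDiagramParityRMoves`, written out with `Relation.EqvGen`).
[cite: Khovanov2000, Thm. 1] -/
theorem nonempty_iso_khovanovHomology_of_eqvGen_rMove_allEven {G G' : GaussDiagram}
    (h : Relation.EqvGen (fun A B ↦ RMove A B ∧ A.AllEven ∧ B.AllEven) G G') (i j : ℤ) :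
    Nonempty (G.khovanovHomology i j ≅ G'.khovanovHomology i j) := by
  induction h with
  | rel A B hAB => exact nonempty_iso_khovanovHomology_of_rMove_of_allEven hAB.1 hAB.2.1 hAB.2.2 i j
  | refl A => exact ⟨Iso.refl _⟩
  | symm A B _ ih => obtain ⟨e⟩ := ih; exact ⟨e.symm⟩
  | trans A B C _ _ ih₁ ih₂ => obtain ⟨e₁⟩ := ih₁; obtain ⟨e₂⟩ := ih₂; exact ⟨e₁ ≪≫ e₂⟩

/-- **Khovanov homology is invariant under `REquiv` between all-even diagrams**: `REquiv`-equivalent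
all-even diagrams are related by moves of `RMove` through all-even diagrams (Manturov's projection
theorem for `RMove`, `eqvGen_rMove_allEven_of_rEquiv`), along which `Kh^{i,j}` is invariant.
[cite: Manturov2011, §3.2 Thm. 2] -/
theorem nonempty_iso_khovanovHomology_of_rEquiv_of_allEven {G G' : GaussDiagram} (hG : G.AllEven)
    (hG' : G'.AllEven) (e : G.REquiv G') (i j : ℤ) :
    Nonempty (G.khovanovHomology i j ≅ G'.khovanovHomology i j) :=
  nonempty_iso_khovanovHomology_of_eqvGen_rMove_allEven (eqvGen_rMove_allEven_of_rEquiv hG hG' e) i j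

/-- **Invariance of Khovanov homology under all oriented Reidemeister moves**: two *realisable*
Gauss diagrams related by `GaussDiagram.REquiv` (the moves of `RMove` — Polyak's moves together with
the anti-parallel second moves `Ω2c/Ω2d`, a generating set of all oriented Reidemeister moves by
Polyak (2010), Thm. 1.2 — and their inverses, possibly through non-realisable diagrams) have
isomorphic Khovanov homology in every bidegree. The analogue for the corrected move set of
`nonempty_iso_khovanovHomology_of_equiv_holds`. Khovanov (2000), Thm. 1; Bar-Natan (2002), Thm. 2.
[cite: Khovanov2000, Thm. 1] -/
theorem nonempty_iso_khovanovHomology_of_rEquiv {G G' : GaussDiagram}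
    (hG : ∃ K : Knot, K.HasGaussDiagram G) (hG' : ∃ K : Knot, K.HasGaussDiagram G')
    (e : G.REquiv G') (i j : ℤ) :
    Nonempty (G.khovanovHomology i j ≅ G'.khovanovHomology i j) := by
  obtain ⟨K, hK⟩ := hG
  obtain ⟨K', hK'⟩ := hG'
  exact nonempty_iso_khovanovHomology_of_rEquiv_of_allEven hK.allEven hK'.allEven e i j

end GaussDiagram

end Literature.Topology.FourManifolds
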